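import Mathlib.RingTheory.MvPolynomial.Symmetric.Defs
import Literature.Computability.AlgebraicComplexity.DeterminantalComplexityProofs
import Literature.Computability.AlgebraicComplexity.BIPPaddingDegenerations
import Literature.Computability.AlgebraicComplexity.ElementarySymmetricCircuit
import Literature.LinearAlgebra.Matrix.PermanentLaplace
import Summits.ValiantsHypothesis.ValiantsHypothesis.Theorems.DetQPDetqpThesisStubPerLeRankPer

/-!
# `DetqpThesis` (stmt-ValiantsHypothesis-0315), line `chow-rank-ladder` — stub S6:
# the bottom pin `dc (e_k) ≤ dc (P n 2)` of the rank ladder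

The rank-`r` permanent is `P n r := per_n (U Vᵀ)`, the generic permanent `perPoly (Fin n) ℂ`
with `x_{ij}` replaced by `Σ_a U_{ia} V_{ja}`, `U_{ia} = X (inl (i, a))`, `V_{ja} = X (inr (j, a))`.
At rank `2` it contains the elementary symmetric polynomials `e_k = MvPolynomial.esymm (Fin n) ℂ k`.

`stub_esymmLeRankTwo`: for `k ≤ n`, `dc (e_k) ≤ dc (P n 2)`.

Proof.
* §1 (a permanent identity over any commutative ring `A`, `permanent_colPattern`).  For
  `x : Fin n → A` and `k ≤ n`, the `n × n` matrix whose `k` columns `j < k` all equal `(x_i)_i`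
  and whose `n - k` columns `j ≥ k` are all ones has permanent `k! (n-k)! · e_k (x)`.  Induction
  on `n`, expanding along the last row (`Matrix.permanent_eq_sum_row`, Minc 1978, §1.2): deleting
  the last row and a column `j < k` (entry `x_last`) leaves the same pattern of size `n - 1` with
  `k - 1` variable columns in `x ∘ castSucc` (`submatrix_colPattern_of_lt`), deleting a column
  `j ≥ k` (entry `1`) the pattern with `k` variable columns (`submatrix_colPattern_of_le`); so
  `per (n, k) = k · x_last · per (n-1, k-1) + (n-k) · per (n-1, k)`, matched with
  `e_k (x) = e_k (x ∘ castSucc) + x_last · e_{k-1} (x ∘ castSucc)` (`esymmMultiset_cons_succ` of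
  `ElementarySymmetricCircuit.lean`).
* §2 Substitute variables and constants (a Valiant projection): `U` of rows `(x_i, 1)`, `V` of rows
  `e₀` (`j < k`) / `e₁` (`j ≥ k`).  Then `(U Vᵀ)_{ij}` is `x_i` for `j < k` and `1` for `j ≥ k`, so
  `P n 2 ↦ k! (n-k)! · e_k` (`isProjection_C_mul_esymm_rankTwo`, via `MvPolynomial.comp_aeval`,
  `aeval_perPoly`, §1 and `MvPolynomial.esymm_eq_multiset_esymm`).
* §3 `dc` is monotone under projections (`determinantalComplexity_le_of_isProjection_holds`), and
  the unit `k! (n-k)!` of `ℂ` is absorbed into one row of an attained representation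
  (`determinantalComplexity_le_C_mul_of_pos`, `hasDetRepr_C_mul`), which has positive size for
  `k ≥ 1` because a size-`0` representation would give `k! (n-k)! · e_k = det () = 1`, whereas the
  constant coefficient of `e_k` vanishes (`constantCoeff_esymm_succ`).  `k = 0`: `e_0 = 1 = det ()`,
  `dc 1 = 0`.

Sources: folklore; P. Bürgisser, *Completeness and Reduction in Algebraic Complexity Theory*
(2000), §2.5 (projections and `dc`); H. Minc, *Permanents* (1978), §1.2 (Laplace expansion);
T. Mignon, N. Ressayre (2004), §1 (affine determinantal representations).
-/

-- single-conjunct layout: Sub = Summit, duplicated namespace component intended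
set_option linter.dupNamespace false

noncomputable section

namespace Summit.ValiantsHypothesis.ValiantsHypothesis.Theorems.DetQPDetqpThesis.ChowRankEsymmLeRankTwo

open MvPolynomial
open Literature.Computability.AlgebraicComplexity

/-! ### §1 The permanent of the matrix with `k` columns `x` and `n - k` columns of ones -/

section Permanent

variable {A : Type*} [CommRing A]

/-- Deleting the last row and a column `j < k + 1` from the `(n+1) × (n+1)` pattern matrix
`(if j < k + 1 then x i else 1)` gives the `n × n` pattern matrix with `k` variable columns in the
variables `x ∘ castSucc`. [folklore] -/
theorem submatrix_colPattern_of_lt {n : ℕ} (x : Fin (n + 1) → A) (k : ℕ) (j : Fin (n + 1))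
    (hj : j.val < k + 1) :
    (Matrix.of fun i c : Fin (n + 1) => if c.val < k + 1 then x i else 1).submatrix
      Fin.castSucc j.succAbove =
    Matrix.of fun i c : Fin n => if c.val < k then x i.castSucc else 1 := by
  ext i c
  simp only [Matrix.submatrix_apply, Matrix.of_apply]
  by_cases h : c.castSucc < j
  · rw [Fin.succAbove_of_castSucc_lt _ _ h, Fin.val_castSucc]
    have h' : c.val < j.val := h
    rw [if_pos (by omega), if_pos (by omega)]
  · rw [Fin.succAbove_of_le_castSucc _ _ (not_lt.mp h), Fin.val_succ]
    by_cases hc : c.val < k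
    · rw [if_pos (by omega), if_pos hc]
    · rw [if_neg (by omega), if_neg hc]

/-- Deleting the last row and a column `j ≥ k` from the `(n+1) × (n+1)` pattern matrix
`(if j < k then x i else 1)` gives the `n × n` pattern matrix with `k` variable columns in the
variables `x ∘ castSucc`. [folklore] -/
theorem submatrix_colPattern_of_le {n : ℕ} (x : Fin (n + 1) → A) (k : ℕ) (j : Fin (n + 1))
    (hj : k ≤ j.val) :
    (Matrix.of fun i c : Fin (n + 1) => if c.val < k then x i else 1).submatrix
      Fin.castSucc j.succAbove =
    Matrix.of fun i c : Fin n => if c.val < k then x i.castSucc else 1 := by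
  ext i c
  simp only [Matrix.submatrix_apply, Matrix.of_apply]
  by_cases h : c.castSucc < j
  · rw [Fin.succAbove_of_castSucc_lt _ _ h, Fin.val_castSucc]
  · rw [Fin.succAbove_of_le_castSucc _ _ (not_lt.mp h), Fin.val_succ]
    have h' : j.val ≤ c.val := not_lt.mp h
    rw [if_neg (by omega), if_neg (by omega)]

/-- `∑_{i < N} (if i < k then a else b) = min k N • a + (N - k) • b`. [folklore] -/
theorem sum_range_ite_lt {M : Type*} [AddCommMonoid M] (k : ℕ) (a b : M) :
    ∀ N : ℕ, (∑ i ∈ Finset.range N, if i < k then a else b) = min k N • a + (N - k) • b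
  | 0 => by simp
  | N + 1 => by
    rw [Finset.sum_range_succ, sum_range_ite_lt k a b N]
    split_ifs with h
    · rw [min_eq_right (by omega : N + 1 ≤ k), min_eq_right (by omega : N ≤ k),
        show N + 1 - k = 0 by omega, show N - k = 0 by omega, zero_nsmul, add_zero, add_zero,
        succ_nsmul]
    · rw [min_eq_left (by omega : k ≤ N + 1), min_eq_left (by omega : k ≤ N),
        show N + 1 - k = (N - k) + 1 by omega, succ_nsmul, add_assoc]

omit [CommRing A] in
/-- The multiset of values of `x : Fin (n+1) → A` is `x (last n)` together with the values of
`x ∘ castSucc`. [folklore] -/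
theorem univ_val_map_eq_cons {n : ℕ} (x : Fin (n + 1) → A) :
    (Finset.univ : Finset (Fin (n + 1))).val.map x =
      x (Fin.last n) ::ₘ (Finset.univ : Finset (Fin n)).val.map (fun i => x i.castSucc) := by
  rw [Fin.univ_castSuccEmb, Finset.cons_val, Multiset.map_cons, Finset.map_val, Multiset.map_map]
  rfl

/-- **The permanent identity.** For `k ≤ n` and `x : Fin n → A`, the permanent of the `n × n`
matrix whose `k` columns `j < k` are all `(x_i)_i` and whose `n - k` columns `j ≥ k` are all ones
is `k! (n-k)! · e_k (x)`: expand along the last row (Minc 1978, §1.2;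
`Matrix.permanent_eq_sum_row`); the `k` entries `x_last` (columns `j < k`) all have the minor
"pattern `(n-1, k-1)` in `x ∘ castSucc`", the `n - k` entries `1` the minor "pattern `(n-1, k)`",
and `e_k (x) = e_k (x ∘ castSucc) + x_last · e_{k-1} (x ∘ castSucc)`. [folklore] -/
theorem permanent_colPattern : ∀ (n : ℕ) (x : Fin n → A) (k : ℕ), k ≤ n →
    (Matrix.of fun i j : Fin n => if j.val < k then x i else 1).permanent =
      ((k.factorial * (n - k).factorial : ℕ) : A) *
        ((Finset.univ : Finset (Fin n)).val.map x).esymm k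
  | 0, x, k, hk => by
    obtain rfl : k = 0 := Nat.le_zero.mp hk
    rw [Matrix.permanent_isEmpty, esymmMultiset_zero_eq_one]
    simp
  | n + 1, x, k, hk => by
    rw [Matrix.permanent_eq_sum_row _ (Fin.last n), Fin.succAbove_last]
    have key : ∀ j : Fin (n + 1),
        (Matrix.of fun i j : Fin (n + 1) => if j.val < k then x i else 1) (Fin.last n) j *
          ((Matrix.of fun i j : Fin (n + 1) => if j.val < k then x i else 1).submatrix
            Fin.castSucc j.succAbove).permanent =
        if j.val < k then x (Fin.last n) *
          (Matrix.of fun i j : Fin n => if j.val < k - 1 then x i.castSucc else 1).permanent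
        else (Matrix.of fun i j : Fin n => if j.val < k then x i.castSucc else 1).permanent := by
      intro j
      rw [Matrix.of_apply]
      split_ifs with hj
      · obtain ⟨k', rfl⟩ : ∃ k', k = k' + 1 := Nat.exists_eq_succ_of_ne_zero (by omega)
        rw [submatrix_colPattern_of_lt x k' j hj, Nat.add_sub_cancel]
      · rw [one_mul, submatrix_colPattern_of_le x k j (not_lt.mp hj)]
    rw [Finset.sum_congr rfl fun j _ => key j,
      Fin.sum_univ_eq_sum_range (fun b => if b < k then x (Fin.last n) *
          (Matrix.of fun i j : Fin n => if j.val < k - 1 then x i.castSucc else 1).permanent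
        else (Matrix.of fun i j : Fin n => if j.val < k then x i.castSucc else 1).permanent) (n + 1),
      sum_range_ite_lt, min_eq_left hk]
    cases k with
    | zero =>
      rw [zero_nsmul, zero_add, permanent_colPattern n _ 0 (Nat.zero_le _),
        esymmMultiset_zero_eq_one, esymmMultiset_zero_eq_one, nsmul_eq_mul, Nat.sub_zero,
        Nat.sub_zero]
      push_cast [Nat.factorial_succ]
      ring
    | succ k' =>
      rw [Nat.add_sub_cancel, Nat.add_sub_add_right, permanent_colPattern n _ k' (by omega),
        univ_val_map_eq_cons, esymmMultiset_cons_succ]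
      rcases Nat.eq_or_lt_of_le hk with h | h
      · -- `k' = n`: no column `j ≥ k`, and `e_{n+1}` of `n` values vanishes
        obtain rfl : k' = n := by omega
        have h0 : ((Finset.univ : Finset (Fin k')).val.map (fun i => x i.castSucc)).esymm
            (k' + 1) = 0 := by
          rw [Multiset.esymm, Multiset.powersetCard_eq_empty _ (by simp), Multiset.map_zero,
            Multiset.sum_zero]
        rw [Nat.sub_self, zero_nsmul, add_zero, nsmul_eq_mul, h0, zero_add]
        push_cast [Nat.factorial_succ]
        ring
      · obtain ⟨t, rfl⟩ := Nat.exists_eq_add_of_le (Nat.lt_succ_iff.mp h)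
        rw [permanent_colPattern (k' + 1 + t) _ (k' + 1) (by omega), nsmul_eq_mul, nsmul_eq_mul,
          show k' + 1 + t - k' = t + 1 by omega, show k' + 1 + t - (k' + 1) = t by omega]
        push_cast [Nat.factorial_succ]
        ring

end Permanent

/-! ### §2 `k! (n-k)! · e_k` is a projection of the rank-`2` permanent `P n 2` -/

/-- The constant coefficient of `e_{k+1}` vanishes. [folklore] -/
theorem constantCoeff_esymm_succ (σ R : Type*) [CommSemiring R] [Fintype σ] (k : ℕ) :
    constantCoeff (MvPolynomial.esymm σ R (k + 1)) = 0 := by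
  simp only [MvPolynomial.esymm, map_sum, map_prod, constantCoeff_X]
  refine Finset.sum_eq_zero fun t ht => ?_
  rw [Finset.prod_const, (Finset.mem_powersetCard.1 ht).2, pow_succ, mul_zero]

/-- **The substitution.** With `U` of rows `(x_i, 1)` and `V` of rows `e₀` (`j < k`) / `e₁`
(`j ≥ k`) — variables and the constants `0, 1` only — the matrix `U Vᵀ` has entry `x_i` in the
`k` columns `j < k` and `1` in the `n - k` columns `j ≥ k`, so `per_n (U Vᵀ) = k! (n-k)! · e_k (x)`
(`permanent_colPattern`); hence `C (k! (n-k)!) * esymm (Fin n) ℂ k` is a Valiant projection of the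
rank-`2` permanent `P n 2` (Bürgisser 2000, Def. 2.6(1)). [folklore] -/
theorem isProjection_C_mul_esymm_rankTwo (n k : ℕ) (hk : k ≤ n) :
    IsProjection (C ((k.factorial * (n - k).factorial : ℕ) : ℂ) * MvPolynomial.esymm (Fin n) ℂ k)
      (aeval (fun x : Fin n × Fin n => ∑ a : Fin 2,
        (X (Sum.inl (x.1, a)) * X (Sum.inr (x.2, a)) :
          MvPolynomial ((Fin n × Fin 2) ⊕ (Fin n × Fin 2)) ℂ))
        (perPoly (Fin n) ℂ)) := by
  refine ⟨Sum.elim (fun ib => if ib.2 = 0 then X ib.1 else 1)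
      (fun jb => if jb.2 = 0 then (if jb.1.val < k then 1 else 0)
        else (if jb.1.val < k then 0 else 1)), ?_, ?_⟩
  · rintro (⟨i, b⟩ | ⟨j, b⟩)
    · simp only [Sum.elim_inl]
      by_cases hb : b = 0
      · exact Or.inl ⟨i, by rw [if_pos hb]⟩
      · exact Or.inr ⟨1, by rw [if_neg hb, C_1]⟩
    · simp only [Sum.elim_inr]
      refine Or.inr ?_
      split_ifs
      exacts [⟨1, C_1.symm⟩, ⟨0, C_0.symm⟩, ⟨0, C_0.symm⟩, ⟨1, C_1.symm⟩]
  · symm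
    rw [comp_aeval_apply, aeval_perPoly]
    have hM : (Matrix.of fun i j : Fin n => aeval (Sum.elim
        (fun ib : Fin n × Fin 2 => if ib.2 = 0 then (X ib.1 : MvPolynomial (Fin n) ℂ) else 1)
        (fun jb : Fin n × Fin 2 => if jb.2 = 0 then (if jb.1.val < k then 1 else 0)
          else (if jb.1.val < k then 0 else 1)))
        (∑ a : Fin 2, (X (Sum.inl ((i, j).1, a)) * X (Sum.inr ((i, j).2, a)) :
          MvPolynomial ((Fin n × Fin 2) ⊕ (Fin n × Fin 2)) ℂ))) =
        Matrix.of fun i j : Fin n => if j.val < k then X i else 1 := by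
      have h10 : (1 : Fin 2) ≠ 0 := by decide
      ext i j : 1
      simp only [Matrix.of_apply, Fin.sum_univ_two, map_add, map_mul, aeval_X, Sum.elim_inl,
        Sum.elim_inr, h10, if_true, if_false]
      split_ifs <;> ring
    rw [hM, permanent_colPattern n X k hk, map_natCast]
    exact congrArg _ (congrFun (esymm_eq_multiset_esymm (Fin n) ℂ) k).symm

/-! ### §3 Unit scalars and the conclusion -/

/-- **Absorbing a unit.** If `c ≠ 0` and `dc (c · f) > 0` then `dc f ≤ dc (c · f)`: scale the
first row of an attained representation of `c · f` (`hasDetRepr_determinantalComplexity_holds`)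
by `c⁻¹` (`hasDetRepr_C_mul`) (Mignon–Ressayre 2004, §1). [folklore] -/
theorem determinantalComplexity_le_C_mul_of_pos {K : Type*} [Field K] {τ : Type*} {c : K}
    (hc : c ≠ 0) {f : MvPolynomial τ K} (h0 : 0 < determinantalComplexity (C c * f)) :
    determinantalComplexity f ≤ determinantalComplexity (C c * f) := by
  obtain ⟨A, hA, hdet⟩ :=
    hasDetRepr_C_mul c⁻¹ h0 (hasDetRepr_determinantalComplexity_holds (C c * f))
  refine determinantalComplexity_le_of_hasDetRepr ⟨A, hA, ?_⟩
  rw [hdet, ← mul_assoc, ← C_mul, inv_mul_cancel₀ hc, C_1, one_mul]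

/-- **S6 — the bottom pin of the rank ladder: `dc (e_k) ≤ dc (P n 2)` for `k ≤ n`.**
For `k = 0`, `dc (e_0) = dc 1 = 0`.  For `k ≥ 1`, the substitution `U = [x | 1]`,
`V = [e₀ × k; e₁ × (n-k)]` (variables and constants) turns `P n 2 = per_n (U Vᵀ)` into
`k! (n-k)! · e_k (x)` (`isProjection_C_mul_esymm_rankTwo`), so `dc (k! (n-k)! · e_k) ≤ dc (P n 2)`
(`determinantalComplexity_le_of_isProjection_holds`, Bürgisser 2000, §2.5); and
`dc (k! (n-k)! · e_k) > 0` (a size-`0` representation would make `k! (n-k)! · e_k = 1`, but its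
constant coefficient vanishes, `constantCoeff_esymm_succ`), so the unit `k! (n-k)!` of `ℂ` is
removed by `determinantalComplexity_le_C_mul_of_pos`. [folklore] -/
theorem stub_esymmLeRankTwo : ∀ n k : ℕ, k ≤ n →
    determinantalComplexity (MvPolynomial.esymm (Fin n) ℂ k)
    ≤ determinantalComplexity (aeval (fun x : Fin n × Fin n => ∑ a : Fin 2,
      (X (Sum.inl (x.1, a)) * X (Sum.inr (x.2, a)) : MvPolynomial ((Fin n × Fin 2) ⊕ (Fin n × Fin 2)) ℂ))
      (perPoly (Fin n) ℂ)) := by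
  intro n k hk
  cases k with
  | zero =>
    rw [esymm_zero]
    exact (determinantalComplexity_le_of_hasDetRepr
      Summit.ValiantsHypothesis.Theorems.DetqpThesis.Negative.hasDetRepr_one_zero).trans
      (Nat.zero_le _)
  | succ k =>
    refine le_trans (determinantalComplexity_le_C_mul_of_pos ?_ ?_)
      (determinantalComplexity_le_of_isProjection_holds
        (isProjection_C_mul_esymm_rankTwo n (k + 1) hk))
    · exact_mod_cast Nat.mul_ne_zero (Nat.factorial_ne_zero _) (Nat.factorial_ne_zero _)
    · refine Nat.pos_of_ne_zero fun h0 => ?_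
      have hrep := hasDetRepr_determinantalComplexity_holds
        (C (((k + 1).factorial * (n - (k + 1)).factorial : ℕ) : ℂ) *
          MvPolynomial.esymm (Fin n) ℂ (k + 1))
      rw [h0] at hrep
      obtain ⟨A, -, hdet⟩ := hrep
      rw [Matrix.det_isEmpty] at hdet
      have h1 := congrArg constantCoeff hdet
      rw [map_one, map_mul, constantCoeff_C, constantCoeff_esymm_succ, mul_zero] at h1
      exact one_ne_zero h1

end Summit.ValiantsHypothesis.ValiantsHypothesis.Theorems.DetQPDetqpThesis.ChowRankEsymmLeRankTwo

end
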